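import Literature.Topology.FourManifolds.ClosedBallTangent
import Mathlib.Analysis.InnerProductSpace.Calculus
import Mathlib.Analysis.SpecialFunctions.Sqrt
import HarnessLib

/-!
# The radial coordinate of tangent vectors at the boundary of the closed ball `𝔻ⁿ⁺¹`
(topic `Topology/FourManifolds`)

A complement to `ClosedBallTangent.lean` (tangent vectors of the closed unit ball
`𝔻ⁿ⁺¹ ⊆ ℝⁿ⁺¹` read ambiently through `closedBallCoeDeriv x = Dι_x`, the differential of the
inclusion), needed whenever a vector field has to be shown to point OUT of the ball in the sense
used by the tree's hypersurface statements ("the `0`-th half-space coordinate of the vector in the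
chart at the boundary point is negative", e.g. the outward unit normal in
`Literature.Geometry.Riemannian.Sweeney2026_pscMeanConvex`): at a boundary point `x`, `‖x‖ = 1`,
the preferred chart of `𝔻ⁿ⁺¹` is the polar chart `w ↦ (1 - ‖w‖, σ(w/‖w‖))`
(`ClosedBall.lean`, `ClosedBallProofs.lean`), whose `0`-th coordinate `1 - ‖w‖` has differential
`-⟪x, ·⟫` at `x`; hence

* `closedBallCoeDeriv_symm_apply_zero` — `((Dι_x)⁻¹ w)₀ = -⟪x, w⟫` for every ambient vector `w`;
* `apply_zero_eq_neg_inner_closedBallCoeDeriv` — equivalently `v₀ = -⟪x, Dι_x v⟫` for every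
  tangent vector `v ∈ T_x 𝔻ⁿ⁺¹` (the general-dimension form of the lemma of the same name proved
  for `𝔻⁴` in `Geometry/Symplectic/SteinBallContact.lean`);
* `norm_coe_boundaryData_incl`, `BoundaryData.mdifferentiableAt_incl` — bookkeeping: points in
  the image of a boundary datum of `𝔻ⁿ⁺¹` have norm `1` (`boundary_closedBall`), and the inclusion
  of any boundary datum is differentiable.

All PROVED; elementary (Lee 2013, Ch. 1, boundary charts; the derivative of the norm).

## References

* J. M. Lee, *Introduction to Smooth Manifolds*, 2nd ed., GTM 218 (2013), Ch. 1 (manifolds with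
  boundary, Problem 1-11: the closed ball), Ch. 3 (tangent vectors in coordinates). [Lee2013]
-/

noncomputable section

open scoped Manifold ContDiff Topology RealInnerProductSpace
open Bundle Set Function Metric

namespace Literature.Topology.FourManifolds

section Radial

variable (n : ℕ)

/-- **In the boundary charts of `𝔻ⁿ⁺¹` the `0`-th coordinate of a tangent vector is minus the radial
component of its ambient representative**: at `‖x‖ = 1`, `((Dι_x)⁻¹ w)₀ = -⟪x, w⟫` (the boundary chart
is the polar chart `w ↦ (1 - ‖w‖, σ(w/‖w‖))`). [folklore] -/
theorem closedBallCoeDeriv_symm_apply_zero {x : Metric.closedBall (0 : EuclideanSpace ℝ (Fin (n + 1))) 1} (hx : ‖(x : EuclideanSpace ℝ (Fin (n + 1)))‖ = 1)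
    (w : EuclideanSpace ℝ (Fin (n + 1))) :
    ((closedBallCoeDeriv x).symm w) 0 = -⟪(x : EuclideanSpace ℝ (Fin (n + 1))), w⟫ := by
  haveI := fact_finrank_euclideanSpace_succ n
  set p : sphere (0 : EuclideanSpace ℝ (Fin (n + 1))) 1 := ⟨x, mem_sphere_zero_iff_norm.2 hx⟩ with hp
  have hx0 : (x : EuclideanSpace ℝ (Fin (n + 1))) ≠ 0 := by
    rw [← norm_ne_zero_iff, hx]; exact one_ne_zero
  -- the `0`-th coordinate of the polar chart is `1 - ‖w‖`
  have hcoord : (fun w : EuclideanSpace ℝ (Fin (n + 1)) ↦ (EuclideanSpace.proj (0 : Fin (n + 1)) :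
      EuclideanSpace ℝ (Fin (n + 1)) →L[ℝ] ℝ) (polarChart p w)) = fun w ↦ 1 - ‖w‖ := by
    funext w
    rw [polarChart_apply]
    rfl
  -- derivative of the norm at `x`
  have hnorm : HasFDerivAt (fun w : EuclideanSpace ℝ (Fin (n + 1)) ↦ 1 - ‖w‖)
      (0 - (1 / (2 * √(‖(x : EuclideanSpace ℝ (Fin (n + 1)))‖ ^ 2))) •
        (2 • innerSL ℝ (x : EuclideanSpace ℝ (Fin (n + 1))))) (x : EuclideanSpace ℝ (Fin (n + 1))) := by
    have h1 := ((hasStrictFDerivAt_norm_sq (x : EuclideanSpace ℝ (Fin (n + 1)))).hasFDerivAt).sqrt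
      (by rw [hx]; norm_num)
    have h2 : (fun w : EuclideanSpace ℝ (Fin (n + 1)) ↦ √(‖w‖ ^ 2)) = fun w ↦ ‖w‖ :=
      funext fun w ↦ Real.sqrt_sq (norm_nonneg w)
    rw [h2] at h1
    exact (hasFDerivAt_const 1 _).sub h1
  have hpolar : HasFDerivAt (polarChart p) (fderiv ℝ (polarChart p) (x : EuclideanSpace ℝ (Fin (n + 1))))
      (x : EuclideanSpace ℝ (Fin (n + 1))) :=
    (((contDiffOn_polarChart p).differentiableOn (by simp)).differentiableAt
      ((polarChart p).open_source.mem_nhds (mem_polarChart_source_self p))).hasFDerivAt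
  have hcomp := ((EuclideanSpace.proj (0 : Fin (n + 1)) :
      EuclideanSpace ℝ (Fin (n + 1)) →L[ℝ] ℝ).hasFDerivAt.comp _ hpolar)
  rw [show ((EuclideanSpace.proj (0 : Fin (n + 1)) : EuclideanSpace ℝ (Fin (n + 1)) →L[ℝ] ℝ) ∘
      polarChart p) = fun w ↦ 1 - ‖w‖ from hcoord] at hcomp
  have heq := hcomp.unique hnorm
  have key : (fderiv ℝ (polarChart p) (x : EuclideanSpace ℝ (Fin (n + 1))) w) 0 =
      -⟪(x : EuclideanSpace ℝ (Fin (n + 1))), w⟫ := by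
    have h1 := congrArg (fun L : EuclideanSpace ℝ (Fin (n + 1)) →L[ℝ] ℝ ↦ L w) heq
    simp only [ContinuousLinearMap.coe_comp, comp_apply, sub_apply, smul_apply,
      zero_apply, innerSL_apply_apply, nsmul_eq_mul, Nat.cast_ofNat, smul_eq_mul,
      hx, one_pow, Real.sqrt_one, mul_one] at h1
    have h2 : (EuclideanSpace.proj (0 : Fin (n + 1)) : EuclideanSpace ℝ (Fin (n + 1)) →L[ℝ] ℝ)
        (fderiv ℝ (polarChart p) (x : EuclideanSpace ℝ (Fin (n + 1))) w) =
        (fderiv ℝ (polarChart p) (x : EuclideanSpace ℝ (Fin (n + 1))) w) 0 := rfl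
    rw [← h2, h1]
    ring
  have h := congrArg (fun L : EuclideanSpace ℝ (Fin (n + 1)) →L[ℝ] EuclideanSpace ℝ (Fin (n + 1)) ↦ L w)
    (coe_closedBallCoeDeriv_symm x)
  simp only [ContinuousLinearEquiv.coe_coe] at h
  rw [h, closedBallAmbChart_of_norm_eq_one hx]
  exact key

/-- **In the boundary charts the radial coordinate of a tangent vector is `-⟪x, Dι_x v⟫`**: at a
boundary point `x` (`‖x‖ = 1`), the `0`-th chart coordinate of `v ∈ T_x𝔻ⁿ⁺¹` is minus the radial
component of its ambient representative. [folklore] -/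
theorem apply_zero_eq_neg_inner_closedBallCoeDeriv {x : Metric.closedBall (0 : EuclideanSpace ℝ (Fin (n + 1))) 1}
    (hx : ‖(x : EuclideanSpace ℝ (Fin (n + 1)))‖ = 1) (v : EuclideanSpace ℝ (Fin (n + 1))) :
    v 0 = -⟪(x : EuclideanSpace ℝ (Fin (n + 1))), closedBallCoeDeriv x v⟫ := by
  rw [← closedBallCoeDeriv_symm_apply_zero n hx (closedBallCoeDeriv x v),
    ContinuousLinearEquiv.symm_apply_apply]

variable {n}

/-- Points in the image of a boundary datum of `𝔻ⁿ⁺¹` have norm `1` (`boundary_closedBall`).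
[folklore] -/
theorem norm_coe_boundaryData_incl (bX : BoundaryData (𝓡∂ (n + 1))
    (Metric.closedBall (0 : EuclideanSpace ℝ (Fin (n + 1))) 1) (𝓡 n)) (z : bX.carrier) :
    ‖((bX.incl z : Metric.closedBall (0 : EuclideanSpace ℝ (Fin (n + 1))) 1) :
      EuclideanSpace ℝ (Fin (n + 1)))‖ = 1 := by
  have h := bX.incl_mem_boundary z
  rw [boundary_closedBall] at h
  exact h

end Radial

/-- The inclusion of a boundary datum is differentiable (it is a `C^∞` embedding). [folklore] -/
theorem BoundaryData.mdifferentiableAt_incl {E H E₀ H₀ : Type*} [NormedAddCommGroup E]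
    [NormedSpace ℝ E] [TopologicalSpace H] {I : ModelWithCorners ℝ E H} [NormedAddCommGroup E₀]
    [NormedSpace ℝ E₀] [TopologicalSpace H₀] {I₀ : ModelWithCorners ℝ E₀ H₀} {M : Type*}
    [TopologicalSpace M] [ChartedSpace H M] (b : BoundaryData I M I₀) (z : b.carrier) :
    MDifferentiableAt I₀ I b.incl z :=
  (b.isSmoothEmbedding.contMDiff z).mdifferentiableAt (by simp)

end Literature.Topology.FourManifolds

end
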